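import Summits.ResolutionOfSingularities.ResolutionOfSingularities.Theorems.PurelyInseparableDim4ChartAtlasReading
import Summits.ResolutionOfSingularities.ResolutionOfSingularities.Theorems.PurelyInseparableDim4ChartAtlasShear
import Summits.ResolutionOfSingularities.ResolutionOfSingularities.Theorems.PurelyInseparableDim4ChartCover
import HarnessLib

/-!
# Purely inseparable four-folds `z^p + F(x₁, …, x₄)`: the charts `x_l`, `l ∈ S ∖ S'`, COVER the escaping global
# centre (brick S3-N1 «atlas of an escaping global centre», part E3; cell `res-dim4-pi`, typ-2 g5)

[OURS · counted 0] (D-0157 DOOR 2; DR-157-C; desk WORD #115 (a) (S3-N1) «cover of `Zc` by the charts `W[⊤, x_λ]`,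
`λ ∈ Λ_S ∖ Λ_{S'}`»; frame `PIDim4.TerminationImpliesOrderReduction`, S3 (c)). Setting of E2 (`…ChartAtlasReading`):
`π : W → 𝔸⁵_K` ANY blowing up along `V(z, x_S)`, `j ∈ S ∖ S'`, the graph `Y = V(J_Y)` of A2/B1 whose strict transform is
the global centre `Zc` of the next coordinate centre `S'`. PROVED here (no `sorry`, no new axiom):

* §1 `chartImm_apply_mem_opensRange_of_not_mem` — CHART OVERLAP for ANY blowing up of `𝔸⁵` along `V(x_Λ)`: a point of
  the `x_i`-chart at which `x_m` (`m ∈ Λ`) does not vanish lies in the `x_m`-chart (the tree's chart ratios, as in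
  `…ChartCover` for the `z`-chart);
* §2 `one_sub_mem_coordStrictTransformIdeal_graph` — on the `x_i`-chart of a centre variable `i ∈ S' ∩ S` the strict
  transform of `Y` contains `1 − bᵢ x_j` (from the generator `xᵢ − bᵢ x_j`), so
  `support_strictTransformIdeal_graph_inter_opensRange_subset` — its points in that chart lie in the `x_j`-chart;
* §3 **`support_strictTransformIdeal_graph_subset_iUnion`**, **`support_globalCentre_subset_iUnion`** —
  `V(Zc) ⊆ ⋃_{l ∈ S ∖ S'} W[⊤, x_l]`: THE ESCAPING GLOBAL CENTRE IS COVERED BY THE CHARTS `x_l`, `l ∈ S ∖ S'`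
  (`V(Zc) ⊆ supp M' ⊆ ⋃_{i ∈ S} W[⊤, xᵢ]` by Q2 and `…ChartCover`; the charts `i ∈ S'` are absorbed by the `x_j`-chart).

With E2 (every such chart reads `Zc` as `V(z, x_{S'})` and the transform as a clean permissible `z^p + F_l`) this is the
finite ATLAS of the escaping child asked for by typ-3's joint forest v3. HONEST SCOPE: `K` perfect of characteristic `p`
(Q2). Nothing about the snc/shape of older boundary members (S3-N2), the walk over the added points, or termination;
resolution of singularities in dimension ≥ 4 / characteristic `p` is NOT proved anywhere in this programme. bears_on:
LADDER-RESOLUTION:D157-DOOR2 (res-dim4-pi). Supports stmt-ResolutionOfSingularities-16155 (helper, S3-N1 E3).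
-/

-- every declaration of this summit lives under `Summit.ResolutionOfSingularities.ResolutionOfSingularities`
-- (summit = problem), which the duplicate-namespace linter flags; house convention (cf. the Target file).
set_option linter.dupNamespace false

noncomputable section

open MvPolynomial Finset CategoryTheory AlgebraicGeometry Opposite TopologicalSpace
open AlgebraicGeometry.Scheme.IdealSheafData (ofIdealTop vanishingIdeal)

namespace Summit.ResolutionOfSingularities.ResolutionOfSingularities.Theorems.PIDim4

open Literature.AlgebraicGeometry.Resolution
open Literature.AlgebraicGeometry.Resolution.AffinePointBlowup (P A γ coord Wtop ξ)

namespace ChartDictionary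

/-! ## §1 Chart overlap: `x_m` invertible on the `x_i`-chart ⇒ in the `x_m`-chart -/

section Overlap

variable {K : Type} [Field K] {Λ : Set (Fin (4 + 1))} {W : Scheme.{0}} {π : W ⟶ P 4 K}

/-- **A point of the `x_i`-chart at which `x_m` (`m ∈ Λ`, `m ≠ i`) does not vanish lies in the `x_m`-chart**, for ANY
blowing up `π : W → 𝔸⁵_K` along `V(x_Λ)`. The ratio `T = π^*x_m / π^*x_i` on the `x_i`-chart
(`IsBlowup.exists_chartRatio`) has `D(T) = W[x_i] ∩ W[x_m]` (`IsBlowup.basicOpen_chartRatio`), and its pull-back to the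
affine space of the `x_i`-chart is `x_m` (`π^*x_m ↦ x_i x_m`, `π^*x_i ↦ x_i`, `x_i` a nonzerodivisor) — verbatim the
tree's `chartImm_zero_apply_mem_opensRange_succ` with the `z`-chart replaced by the `x_i`-chart. -/
theorem chartImm_apply_mem_opensRange_of_not_mem (hπ : IsBlowup π (AffineCoordBlowup.𝓘Λ 4 K Λ))
    {i m : Fin (4 + 1)} (hi : i ∈ Λ) (hm : m ∈ Λ) (hmi : m ≠ i) {y : P 4 K} (hy : (X m : A 4 K) ∉ y.asIdeal) :
    AffineCoordBlowup.chartImm hπ hi y ∈ (AffineCoordBlowup.chartImm hπ hm).opensRange := by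
  have hiI := AffineCoordBlowup.coord_mem_𝓘Λ 4 K _ hi
  have hmI := AffineCoordBlowup.coord_mem_𝓘Λ 4 K _ hm
  -- the ratio `T = π^*x_m / π^*x_i` on the `x_i`-chart and its basic open
  obtain ⟨T, hT⟩ := hπ.exists_chartRatio (Wtop 4 K) hiI hmI
  have hbo := hπ.basicOpen_chartRatio (Wtop 4 K) hiI hmI hT
  rw [AffineCoordBlowup.opensRange_chartImm hπ hm]
  change _ ∈ blowupChart π (AffineCoordBlowup.𝓘Λ 4 K Λ) (Wtop 4 K) (coord 4 K m)
  suffices hmem : AffineCoordBlowup.chartImm hπ hi y ∈ W.basicOpen T by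
    rw [hbo] at hmem
    exact hmem.2
  -- the `x_i`-chart `cᵢ : 𝔸⁵ → W` and the open `V = cᵢ⁻¹ W[x_i]` (all of `𝔸⁵`)
  set cᵢ := AffineCoordBlowup.chartImm hπ hi with hcᵢ
  have hyV : y ∈ cᵢ ⁻¹ᵁ blowupChart π (AffineCoordBlowup.𝓘Λ 4 K Λ) (Wtop 4 K) (coord 4 K i) := by
    change cᵢ y ∈ AffineCoordBlowup.chart Λ π i
    rw [← AffineCoordBlowup.opensRange_chartImm hπ hi]
    exact ⟨y, rfl⟩
  change y ∈ cᵢ ⁻¹ᵁ W.basicOpen T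
  rw [Scheme.preimage_basicOpen]
  -- `𝔸⁵` is integral: sections over the nonempty `V` form a domain, restriction from `⊤` is injective
  haveI : Nonempty (P 4 K) := ⟨ξ 4 K⟩
  haveI : IsDomain Γ(P 4 K, ⊤) := AffinePointBlowup.isDomain_Γ 4 K
  haveI : IsIntegral (P 4 K) := isIntegral_of_isAffine_of_isDomain (P 4 K)
  haveI : IsDomain Γ(P 4 K, cᵢ ⁻¹ᵁ blowupChart π (AffineCoordBlowup.𝓘Λ 4 K Λ) (Wtop 4 K) (coord 4 K i)) :=
    @IsIntegral.component_integral (P 4 K) _ _ ⟨⟨y, hyV⟩⟩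
  set ρ := (P 4 K).presheaf.map (homOfLE (le_top :
    cᵢ ⁻¹ᵁ blowupChart π (AffineCoordBlowup.𝓘Λ 4 K Λ) (Wtop 4 K) (coord 4 K i) ≤ ⊤)).op with hρ
  have hρinj : Function.Injective ρ :=
    map_injective_of_isIntegral (X := P 4 K) (homOfLE _) (H := ⟨⟨y, hyV⟩⟩)
  -- `cᵢ^*` of a pulled-back section `π^*s` is `(Spec ψᵢ)^* s`, restricted to `V`
  have key : ∀ s : Γ(P 4 K, ⊤),
      cᵢ.app _ (π.appLE ⊤ _ (blowupChart_le_preimage π (AffineCoordBlowup.𝓘Λ 4 K Λ) (Wtop 4 K) (coord 4 K i)) s) =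
        ρ ((Spec.map (CommRingCat.ofHom (coordBlowupSubst K Λ i).toRingHom)).appTop s) := by
    intro s
    rw [Scheme.Hom.app_eq_appLE, ← CommRingCat.comp_apply, Scheme.Hom.appLE_comp_appLE,
      appLE_congr_hom (AffineCoordBlowup.chartImm_comp hπ hi)]
    rfl
  have hTm := congrArg (cᵢ.app _) hT
  rw [map_mul, key, key] at hTm
  change ρ ((Spec.map _).appTop.hom ((γ 4 K).symm (X m))) = ρ ((Spec.map _).appTop.hom ((γ 4 K).symm (X i))) * _ at hTm
  rw [appTop_specMap_γ_symm, appTop_specMap_γ_symm] at hTm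
  change ρ ((γ 4 K).symm (coordBlowupSubst K _ i (X m))) = ρ ((γ 4 K).symm (coordBlowupSubst K _ i (X i))) * _ at hTm
  rw [coordBlowupSubst_X_self, coordBlowupSubst_X_of_mem_of_ne K _ i hm hmi, map_mul, map_mul] at hTm
  -- cancel `x_i`: the pull-back of `T` is `x_m` restricted to `V`
  have hxi : ρ ((γ 4 K).symm (X i)) ≠ 0 := fun h =>
    AffinePointBlowup.coord_ne_zero 4 K i (hρinj ((h.trans (map_zero _).symm : ρ (coord 4 K i) = ρ 0)))
  have ht : cᵢ.app _ T = ρ ((γ 4 K).symm (X m)) := (mul_left_cancel₀ hxi hTm).symm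
  rw [ht, hρ, Scheme.basicOpen_res]
  refine ⟨hyV, ?_⟩
  change y ∈ (P 4 K).basicOpen ((γ 4 K).symm (X m))
  rw [AffinePointBlowup.γ_symm_apply, basicOpen_eq_of_affine]
  exact hy

/-- Ranges instead of `opensRange`; and a re-centring automorphism in front of the chart does not change the range. -/
theorem range_specMap_comp_chartImm (hπ : IsBlowup π (AffineCoordBlowup.𝓘Λ 4 K Λ)) {i : Fin (4 + 1)} (hi : i ∈ Λ)
    (Θ : A 4 K ≃ₐ[K] A 4 K) :
    Set.range (Spec.map (CommRingCat.ofHom (Θ : A 4 K →+* A 4 K)) ≫ AffineCoordBlowup.chartImm hπ hi) =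
      Set.range (AffineCoordBlowup.chartImm hπ hi) := by
  haveI : IsIso (CommRingCat.ofHom (Θ : A 4 K →+* A 4 K)) :=
    (inferInstance : IsIso Θ.toRingEquiv.toCommRingCatIso.hom)
  have h := Scheme.Hom.opensRange_comp_of_isIso (Spec.map (CommRingCat.ofHom (Θ : A 4 K →+* A 4 K)))
    (AffineCoordBlowup.chartImm hπ hi)
  exact congrArg (fun U : W.Opens => (U : Set W)) h

end Overlap

/-! ## §2 Points of the global centre in a chart `xᵢ`, `i ∈ S'`, lie in the `x_j`-chart -/

section Absorb

variable {K : Type} [Field K] {p : ℕ} {S S' : Finset (Fin 4)} {j : Fin 4} {b : Fin 4 → K}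
  {Θⱼ : A 4 K ≃ₐ[K] A 4 K} {h : MvPolynomial (Fin 4) K} {F F₁ : MvPolynomial (Fin 4) K}
  {W : Scheme.{0}} {π : W ⟶ P 4 K}

/-- On the `xᵢ`-chart of a centre variable `i ∈ S' ∩ S` (`i ≠ j ∈ S`) the strict transform ideal of the graph contains
`1 − bᵢ x_j`: the generator `xᵢ − bᵢ x_j` of `J_Y` becomes `xᵢ (1 − bᵢ x_j)`, and the strict transform is `xᵢ`-saturated. -/
theorem one_sub_mem_coordStrictTransformIdeal_graph (hj : j ∈ S) {i : Fin 4} (hi : i ∈ S' ∩ S) (hij : i ≠ j)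
    (H : MvPolynomial (Fin 4) K) :
    (1 - C (b i) * X j.succ : A 4 K) ∈ coordStrictTransformIdeal K (insert 0 (Fin.succ '' (S : Set (Fin 4)))) i.succ
      (Ideal.span (insert (X 0 - rename Fin.succ H)
        (((fun k : Fin 4 => (X k.succ - C (b k) : A 4 K)) '' ((S' \ S : Finset (Fin 4)) : Set (Fin 4))) ∪
         ((fun i : Fin 4 => (X i.succ - C (b i) * X j.succ : A 4 K)) '' ((S' ∩ S : Finset (Fin 4)) : Set (Fin 4)))))) := by
  obtain ⟨-, hiS⟩ := Finset.mem_inter.mp hi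
  refine mem_of_X_mul_mem K _ i.succ ?_
  have h1 : coordBlowupSubst K (insert 0 (Fin.succ '' (S : Set (Fin 4)))) i.succ (X i.succ - C (b i) * X j.succ : A 4 K) =
      X i.succ * (1 - C (b i) * X j.succ) := by
    rw [map_sub, map_mul, coordBlowupSubst_C, coordBlowupSubst_X_self,
      coordBlowupSubst_X_of_mem_of_ne K _ i.succ (succ_mem_centreVars hj) (fun e => hij (Fin.succ_inj.mp e).symm)]
    ring
  rw [← h1]
  exact coordBlowupSubst_mem K _ i.succ (Ideal.subset_span (Set.mem_insert_of_mem _ (Or.inr ⟨i, Finset.mem_coe.mpr hi, rfl⟩)))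

/-- **Points of `V(St_π(𝒥_Y))` in the `xᵢ`-chart, `i ∈ S' ∩ S`, lie in the `x_j`-chart** (`1 − bᵢ x_j` vanishes there, so
`x_j` is invertible; §1). -/
theorem support_strictTransformIdeal_graph_inter_opensRange_subset (hj : j ∈ S) (hjS' : j ∉ S') {i : Fin 4}
    (hi : i ∈ S' ∩ S) (hπ : IsBlowup π (AffineCoordBlowup.𝓘Λ 4 K (insert 0 (Fin.succ '' (S : Set (Fin 4))))))
    (H : MvPolynomial (Fin 4) K) :
    ((strictTransformIdeal π (AffineCoordBlowup.𝓘Λ 4 K (insert 0 (Fin.succ '' (S : Set (Fin 4)))))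
        (Hironaka2005.idealSheafOf (Ideal.span (insert (X 0 - rename Fin.succ H)
          (((fun k : Fin 4 => (X k.succ - C (b k) : A 4 K)) '' ((S' \ S : Finset (Fin 4)) : Set (Fin 4))) ∪
           ((fun i : Fin 4 => (X i.succ - C (b i) * X j.succ : A 4 K)) '' ((S' ∩ S : Finset (Fin 4)) : Set (Fin 4)))))))).support :
        Set W) ∩ (AffineCoordBlowup.chartImm hπ (succ_mem_centreVars (Finset.mem_inter.mp hi).2)).opensRange ⊆
      (AffineCoordBlowup.chartImm hπ (succ_mem_centreVars hj)).opensRange := by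
  have hij : i ≠ j := fun e => hjS' (e ▸ (Finset.mem_inter.mp hi).1)
  rintro _ ⟨hw, y, rfl⟩
  -- read the strict transform on the `xᵢ`-chart: `J_Y^{st,i} ⊆ 𝔓_y`
  have h1 : y ∈ ((strictTransformIdeal π (AffineCoordBlowup.𝓘Λ 4 K (insert 0 (Fin.succ '' (S : Set (Fin 4)))))
        (Hironaka2005.idealSheafOf (Ideal.span (insert (X 0 - rename Fin.succ H)
          (((fun k : Fin 4 => (X k.succ - C (b k) : A 4 K)) '' ((S' \ S : Finset (Fin 4)) : Set (Fin 4))) ∪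
           ((fun i : Fin 4 => (X i.succ - C (b i) * X j.succ : A 4 K)) ''
             ((S' ∩ S : Finset (Fin 4)) : Set (Fin 4)))))))).comap
      (AffineCoordBlowup.chartImm hπ (succ_mem_centreVars (Finset.mem_inter.mp hi).2))).support := by
    rw [Scheme.IdealSheafData.support_comap]; exact hw
  rw [comap_chartImm_strictTransformIdeal_idealSheafOf (Finset.mem_inter.mp hi).2 hπ, mem_support_idealSheafOf_iff] at h1
  have h2 : (1 - C (b i) * X j.succ : A 4 K) ∈ y.asIdeal := h1 (one_sub_mem_coordStrictTransformIdeal_graph hj hi hij H)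
  -- hence `x_j ∉ 𝔓_y`
  have hxj : (X j.succ : A 4 K) ∉ y.asIdeal := fun h3 => y.2.ne_top ((Ideal.eq_top_iff_one _).mpr (by
    have h4 := y.asIdeal.add_mem h2 (Ideal.mul_mem_left _ (C (b i)) h3)
    rwa [sub_add_cancel] at h4))
  exact chartImm_apply_mem_opensRange_of_not_mem hπ (succ_mem_centreVars (Finset.mem_inter.mp hi).2)
    (succ_mem_centreVars hj) (fun e => hij (Fin.succ_inj.mp e).symm) hxj

/-! ## §3 The cover -/

/-- **`V(St_π(𝒥_Y)) ⊆ ⋃_{l ∈ S ∖ S'} W[⊤, x_l]`** for a graph `Y` containing the permissibility datum: every point of the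
strict transform lies in the support of the transform of `((z^p + F)·𝒪, [], p)` (hypothesis `hsupp`, Q2 in the sequel),
hence in some `xᵢ`-chart, `i ∈ S` (`…ChartCover`); the charts `i ∈ S'` are absorbed by the `x_j`-chart (§2). -/
theorem support_strictTransformIdeal_graph_subset_iUnion {q : ℕ} (hq : q ≠ 0) (hj : j ∈ S) (hjS' : j ∉ S')
    (hπ : IsBlowup π (AffineCoordBlowup.𝓘Λ 4 K (insert 0 (Fin.succ '' (S : Set (Fin 4))))))
    (hperm : (q : ℕ∞) ≤ CentreBlowup.ordAlong S F) (H : MvPolynomial (Fin 4) K)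
    (hsupp : ((strictTransformIdeal π (AffineCoordBlowup.𝓘Λ 4 K (insert 0 (Fin.succ '' (S : Set (Fin 4)))))
        (Hironaka2005.idealSheafOf (Ideal.span (insert (X 0 - rename Fin.succ H)
          (((fun k : Fin 4 => (X k.succ - C (b k) : A 4 K)) '' ((S' \ S : Finset (Fin 4)) : Set (Fin 4))) ∪
           ((fun i : Fin 4 => (X i.succ - C (b i) * X j.succ : A 4 K)) '' ((S' ∩ S : Finset (Fin 4)) : Set (Fin 4)))))))).support :
        Set W) ⊆
      ((⟨hypSheaf q F, [], q⟩ : MarkedIdeal (P 4 K)).transform π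
        (AffineCoordBlowup.𝓘Λ 4 K (insert 0 (Fin.succ '' (S : Set (Fin 4)))))).support) :
    ((strictTransformIdeal π (AffineCoordBlowup.𝓘Λ 4 K (insert 0 (Fin.succ '' (S : Set (Fin 4)))))
        (Hironaka2005.idealSheafOf (Ideal.span (insert (X 0 - rename Fin.succ H)
          (((fun k : Fin 4 => (X k.succ - C (b k) : A 4 K)) '' ((S' \ S : Finset (Fin 4)) : Set (Fin 4))) ∪
           ((fun i : Fin 4 => (X i.succ - C (b i) * X j.succ : A 4 K)) '' ((S' ∩ S : Finset (Fin 4)) : Set (Fin 4)))))))).support :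
        Set W) ⊆
      ⋃ (l : Fin 4) (hl : l ∈ S \ S'),
        ((AffineCoordBlowup.chartImm hπ (succ_mem_centreVars (Finset.mem_sdiff.mp hl).1)).opensRange : Set W) := by
  intro w hw
  obtain ⟨i, hi, hwi⟩ := Set.mem_iUnion₂.mp (support_transform_subset_iUnion hq F hperm [] hπ (hsupp hw))
  by_cases hiS' : i ∈ S'
  · have hwj := support_strictTransformIdeal_graph_inter_opensRange_subset hj hjS' (Finset.mem_inter.mpr ⟨hiS', hi⟩) hπ H
      ⟨hw, hwi⟩
    exact Set.mem_iUnion₂.mpr ⟨j, Finset.mem_sdiff.mpr ⟨hj, hjS'⟩, hwj⟩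
  · exact Set.mem_iUnion₂.mpr ⟨i, Finset.mem_sdiff.mpr ⟨hi, hiS'⟩, hwi⟩

/-- **THE COVER OF THE ESCAPING GLOBAL CENTRE: `V(Zc) ⊆ ⋃_{l ∈ S ∖ S'} W[⊤, x_l]`.** Over a perfect field of
characteristic `p`, for ANY blowing up `π` of `𝔸⁵` along `V(z, x_S)`, `j ∈ S ∖ S'`, `Θⱼ` the re-centring of the `x_j`-chart
reading the transform (`Θⱼ(ψⱼ(z^p + F)) = x_j^p (z^p + F₁)`, `p ≤ ord_{(x_S)} F`) and `S'` permissible for `F₁`: every point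
of the global centre `Zc = 𝓘(closure φⱼ(V(z, x_{S'})))` lies in the `x_l`-chart of some `l ∈ S ∖ S'`. -/
theorem support_globalCentre_subset_iUnion [Fact p.Prime] [CharP K p] [PerfectField K] (hj : j ∈ S) (hjS' : j ∉ S')
    (hbj : b j = 0) (h0j : Θⱼ (X 0) = X 0 + rename Fin.succ h) (hsj : ∀ i : Fin 4, Θⱼ (X i.succ) = X i.succ + C (b i))
    (hπ : IsBlowup π (AffineCoordBlowup.𝓘Λ 4 K (insert 0 (Fin.succ '' (S : Set (Fin 4))))))
    (hperm : (p : ℕ∞) ≤ CentreBlowup.ordAlong S F)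
    (hread : Θⱼ (coordBlowupSubst K (insert 0 (Fin.succ '' (S : Set (Fin 4)))) j.succ (hyp p F)) =
      X j.succ ^ p * hyp p F₁)
    (hperm' : (p : ℕ∞) ≤ CentreBlowup.ordAlong S' F₁) :
    haveI : IsIso (CommRingCat.ofHom (Θⱼ : A 4 K →+* A 4 K)) :=
      (inferInstance : IsIso Θⱼ.toRingEquiv.toCommRingCatIso.hom)
    ((vanishingIdeal (closureImage
        (Spec.map (CommRingCat.ofHom (Θⱼ : A 4 K →+* A 4 K)) ≫ AffineCoordBlowup.chartImm hπ (succ_mem_centreVars hj))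
        ((AffineCoordBlowup.𝓘Λ 4 K (insert 0 (Fin.succ '' (S' : Set (Fin 4))))).support : Set (P 4 K)))).support :
          Set W) ⊆
      ⋃ (l : Fin 4) (hl : l ∈ S \ S'),
        ((AffineCoordBlowup.chartImm hπ (succ_mem_centreVars (Finset.mem_sdiff.mp hl).1)).opensRange : Set W) := by
  have hp0 : p ≠ 0 := (Fact.out : p.Prime).ne_zero
  obtain ⟨H, hH⟩ := exists_lift_twist hj hbj h0j hsj hperm hread hperm'
  have hsupp := support_globalCentre_subset_support_transform hj hbj h0j hsj hπ hperm hread hperm'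
  rw [← strictTransformIdeal_graph_eq_globalCentre hj hjS' hbj h0j hsj hπ hH] at hsupp ⊢
  exact support_strictTransformIdeal_graph_subset_iUnion hp0 hj hjS' hπ hperm H hsupp

end Absorb

end ChartDictionary

end Summit.ResolutionOfSingularities.ResolutionOfSingularities.Theorems.PIDim4

end
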